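import Literature.IUT.LogVolume.GenuineLogThetaPerImageTameContent
import Literature.IUT.LogVolume.TensorPacketShellHull
import HarnessLib

/-!
# Row «C:R22-CREDIT-CHECK»: R22's exact tame per-image bracket in CREDIT/DEBIT form, and the l = 7 toy of abc-iut-inv-6's memo

Proof-only file of the abc-iut cell (KEY `KEY-abc-iut-c312-1-R22CREDIT.md` 07e9e7a927118fb1, C LEAD ruling C-R215; executed by the live
seat abc-iut-f-193 GEN 35 on OFFER, count of record with the C LEAD).  CONTAINER statements only — classical arithmetic about the cell's typed
tensor packets; TAKES NO SIDE on [IUTchIII] Cor. 3.12 / [IUTchIV] Thm. 1.10, on reading (U) vs (P), or on any author; typed ≠ proved;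
calibrated ≠ discharged; NO abc claim.

WHAT IS CHECKED.  abc-iut-c312-1's R22 `realPrimePacketWith_negLogThetaPerImageAt_eq_of_tame`
(`GenuineLogThetaPerImageTameContent.lean`) gives, at a prime `p > 2` over which every field of the family is TAME, the exact value
`−|log(Θ)|^{(P)}_p = (1/ℓ⋆)·Σ_i Σ_{v⃗} (−A(i,v⃗)·log p + log μ̄(packetHull(log_p(R_{v⃗}^×))))·Π_b Pr(v_b)`, `A(i,v⃗) = (v(i,v⃗) − 1) div e + 1 − (j+1)`,
`j + 1 = |Fin (i+1+1)|`.  abc-iut-inv-6's cycle-2 memo `Summits/ABC/ABC/Cruxes/ThetaPartII/INV6-CYCLE2-ADAPTIVE-L-NO-LINE.md` 05267ea3d042c30f §2(b)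
TRANSCRIBES this as a per-label CREDIT `[j(1 − 1/e) + φ_j]·log p`, `φ_j = ((v_j − 1) mod e)/e`, against a DEBIT `(v_j/e)·log p`, and at its toy
(`l = 7`, `c_p = 15`, `e = c_p·l = 105`, `s′ = v_p/2 ∈ {1,2,4}`, `v_j = 15·s′·j²`) as `φ_j = (c_p·(s′j² mod l) − 1)/(c_p·l)` with threshold
`v*_p = 6 + 12/(l+1) − 6(l+5)/(c_p l(l+1)) ∓ 24h(−l)/(l²−1)`.  Neither critic re-checked the transcription against R22.  THIS FILE DECIDES IT:

* §1 `coeff_eq_credit_sub_debit` — the pure `Int.ediv`/`Int.emod` identity behind the transcription: for `0 < E`, every `v : ℤ`, every `j`,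
  `−((v − 1) div E + 1 − (j+1)) − (j+1)/E = j(1 − 1/E) + ((v − 1) mod E)/E − v/E` (real numbers; `div`/`mod` = Lean's Euclidean `/`, `%` on `ℤ`,
  which agree with the memo's for `v ≥ 1`).
* §2 `packetLogμ_packetHull_logPacket_eq_of_tame_of_const`, `bracket_eq_credit_of_tame_of_const` — at a TAME packet all of whose factors have the
  SAME ramification index `E` (the «single-place packet» of the KEY: a `(j+1)`-fold packet over one place), the tree's exact container value
  `log μ̄(packetHull(log_p(R_I^×))) = −(Σ_b 1/e_b)·log p` (abc-iut `TensorPacketShellHull.packetLogμ_packetHull_logPacket_eq_of_tame`) is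
  `−((j+1)/E)·log p`, so R22's bracket IS `(j(1 − 1/E) + ((v−1) mod E)/E − v/E)·log p` — the memo's credit-minus-debit, IDENTICALLY in `v`, `j`, `E`.
* §3 `realPrimePacketWith_negLogThetaPerImageAt_eq_credit_of_tame` — R22 itself rewritten in that form for the GENUINE real prime packet over any
  local-field family with constant tame ramification `E ≤ p − 2` over `p` (inputs BY NAME: R22 + §2; no new analytic content).
* §4 the KEY's toy, slot by slot (`v_p = 2, 4, 8`, i.e. `s′ = 1, 2, 4`; labels `j = 1, 2, 3 = ℓ⋆` at `l = 7`): the memo's closed form of `φ_j`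
  (`toy_emod_eq_memo`), R22's label coefficient `=` the memo's «j(1 − 1/e) + φ_j − v_j/e» with the memo's numbers on the right
  (`slot_two`, `slot_four`, `slot_eight`), the slot sums `Σ_{j≤3} v_j/e = v_p` and `Σ_{j≤3}(j(1 − 1/e) + φ_j) = 242/35` (`slot_sums`), and the
  threshold in both of the memo's closed forms `6(1 − 1/e) + 48Φ/(l²−1) = 6 + 12/(l+1) − 6(l+5)/(c_p l(l+1)) − 24·h(−7)/(l²−1) = 242/35` with
  `h(−7) = 1` ENTERED AS A NUMERAL (`toy_threshold`) — OUTCOME (α) MATCH at all three slots; under the KEY's second reading «labels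
  j = 1…7» the closed form of `φ_j` persists for `j = 4, 5, 6` (`toy_emod_eq_memo_reading_B`) and fails only at `j = 7 = l`, which the memo's
  hypothesis `l ∤ s′j²` excludes (`toy_label_seven_outside_memo_range`, a recorded separating instance, not a (β) verdict on the memo's range).

DICTIONARY (stated, as the KEY asks): memo «label j» = R22's `i + 1` (`i : Fin ℓ⋆`), «j + 1» = `Fintype.card (Fin (i+1+1))`, «e» = the common
`absRamificationIdx p (K_{v̲_b})` of the collection, «v_j» = R22's `v i v⃗` (the last-slot valuation numerator), «ℓ⋆» = R22's `lstar` (= 3 at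
`l = 7`; the other natural reading «labels j = 1…7» changes nothing in §1–§3, which hold for every `j`).  The `1/ℓ⋆` and the weights `Π_b Pr(v_b)`
are common to both sides and untouched.

HONEST SCOPE: statements about OUR typed packets / hulls / reading (P) only; the class-number step of the memo (`Σ_j φ_j` via quadratic residues
and `h(−l)`) is NOT formalised — only its value at `l = 7` is checked against the label-by-label sum; nothing here bears on which reading or
indeterminacy print means.  [cite: Mochizuki2012, IUTchIII Cor. 3.12 proof Step (x) p. 181; IUTchIV Prop. 1.2 (i)(ii) p. 10–11]
[cite: DupuyHilado2025, §4.9, §4.12] [claim: Mochizuki2012, status: disputed] for every IUT quotation.  PROOF-ONLY: no definition, no instance,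
no notation, no `Prop` fact.
-/

set_option autoImplicit false

noncomputable section

open Set Module Function NumberField IsDedekindDomain
open scoped Pointwise TensorProduct NormedField

namespace Literature.IUT.LogVolume

namespace TameCreditCheck

/-! ## §1 The `Int.ediv`/`Int.emod` identity behind the memo's transcription -/

/-- **The transcription identity.** For `0 < E`, every `v : ℤ` and every label `j`:
`−((v − 1) div E + 1 − (j+1)) − (j+1)/E = j(1 − 1/E) + ((v − 1) mod E)/E − v/E` in `ℝ` — R22's bracket coefficient (with the tame container
value `−(j+1)/E` substituted) equals the memo's «credit `j(1 − 1/e) + φ_j` minus debit `v/e`», `φ = ((v−1) mod e)/e`.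
[cite: DupuyHilado2025, §4.12] -/
theorem coeff_eq_credit_sub_debit (E : ℕ) (hE : 0 < E) (v : ℤ) (j : ℕ) :
    ((-((v - 1) / (E : ℤ) + 1 - ((j + 1 : ℕ) : ℤ)) : ℤ) : ℝ) + -(((j + 1 : ℕ) : ℝ) * (1 / (E : ℝ))) =
      (j : ℝ) * (1 - 1 / (E : ℝ)) + (((v - 1) % (E : ℤ) : ℤ) : ℝ) / E - (v : ℝ) / E := by
  have h := Int.emod_add_ediv_mul (v - 1) (E : ℤ)   -- `(v-1) % E + (v-1) / E * E = v - 1`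
  have hE' : (E : ℝ) ≠ 0 := by exact_mod_cast hE.ne'
  set q : ℤ := (v - 1) / (E : ℤ) with hqdef
  set r : ℤ := (v - 1) % (E : ℤ) with hrdef
  have hq : (q : ℝ) = ((v : ℝ) - 1 - r) / E := by
    rw [eq_div_iff hE']
    have h' : (r : ℝ) + (q : ℝ) * ((E : ℤ) : ℝ) = (((v - 1 : ℤ)) : ℝ) := by exact_mod_cast h
    push_cast at h'
    linarith
  push_cast
  rw [hq]
  field_simp
  ring

/-! ## §2 Packet level: the bracket at a tame packet of constant ramification -/

section Packet

variable (p : ℕ) [hp : Fact p.Prime]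
variable {I : Type} [Fintype I] [DecidableEq I] [Nonempty I]
variable (k : I → Type) [∀ i, NontriviallyNormedField (k i)] [∀ i, NormedAlgebra ℚ_[p] (k i)]
  [∀ i, IsUltrametricDist (k i)] [∀ i, ProperSpace (k i)]

/-- **Container value at constant tame ramification**: if every factor of the packet has ramification index `E ≤ p − 2` (`p > 2`), then
`log μ̄(packetHull(log_p(R_I^×))) = −(|I|/E)·log p` (the tree's `packetLogμ_packetHull_logPacket_eq_of_tame`, summed at a constant).
[cite: Mochizuki2012, IUTchIV Prop. 1.2 (i) p. 10] [cite: DupuyHilado2025, §4.12] -/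
theorem packetLogμ_packetHull_logPacket_eq_of_tame_of_const (hp2 : 2 < p) {E : ℕ}
    (hE : ∀ i, absRamificationIdx p (k i) = E) (hEt : E ≤ p - 2) :
    packetLogμ p k (packetHull p k (logPacket p k : Set (PacketAlgebra p k))) =
      -((Fintype.card I : ℝ) * (1 / (E : ℝ))) * Real.log p := by
  rw [packetLogμ_packetHull_logPacket_eq_of_tame p k hp2 (fun i => (hE i).le.trans hEt)]
  congr 2
  simp [hE, Finset.sum_const, Finset.card_univ, nsmul_eq_mul]

/-- **R22's bracket in credit/debit form at a tame packet of constant ramification `E`** (`0 < E ≤ p − 2`, `p > 2`, `|I| = j + 1`):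
`−((v−1) div E + 1 − |I|)·log p + log μ̄(packetHull(log_p(R_I^×))) = (j(1 − 1/E) + ((v−1) mod E)/E − v/E)·log p`.
[cite: Mochizuki2012, IUTchIV Prop. 1.2 (i)(ii) p. 10–11] [cite: DupuyHilado2025, §4.9, §4.12] -/
theorem bracket_eq_credit_of_tame_of_const (hp2 : 2 < p) {E : ℕ} (hE : ∀ i, absRamificationIdx p (k i) = E)
    (hEt : E ≤ p - 2) (hE0 : 0 < E) (v : ℤ) (j : ℕ) (hI : Fintype.card I = j + 1) :
    -(((((v - 1) / (E : ℤ) + 1 - Fintype.card I : ℤ)) : ℝ) * Real.log p) +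
        packetLogμ p k (packetHull p k (logPacket p k : Set (PacketAlgebra p k))) =
      ((j : ℝ) * (1 - 1 / (E : ℝ)) + (((v - 1) % (E : ℤ) : ℤ) : ℝ) / E - (v : ℝ) / E) * Real.log p := by
  rw [packetLogμ_packetHull_logPacket_eq_of_tame_of_const p k hp2 hE hEt, hI,
    ← coeff_eq_credit_sub_debit E hE0 v j]
  push_cast
  ring

end Packet

/-! ## §3 The genuine real prime packet: R22 in credit/debit form at constant tame ramification over `p` -/

section RealPacketWith

variable {F : Type} [Field F] [NumberField F]
variable (p : ℕ) [hp : Fact p.Prime] (𝔽 : LocalFields F p)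
variable (c : (j : ℕ) → (Fin (j + 1) → placesOver F p) → ℚ_[p]) (hc0 : ∀ j e, c j e ≠ 0)
  (hcσ : ∀ (j : ℕ) (σ : Equiv.Perm (Fin (j + 1))) (e : Fin (j + 1) → placesOver F p), c j (e ∘ σ) = c j e)

/-- **`−|log(Θ)|^{(P)}_p` AT A TAME PRIME OF CONSTANT RAMIFICATION, IN CREDIT/DEBIT FORM.**  Real prime packet over ANY local-field family; if
every `K_{v̲}`, `v ∣ p`, has the same ramification index `E ≤ p − 2` (`p > 2`) — e.g. a single place over `p` — and `v(i,v⃗) ∈ ℤ` records the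
last-slot valuations `‖t_{i,v_j}‖ = p^{−v(i,v⃗)/E}`, then
`−|log(Θ)|^{(P)}_p = (1/ℓ⋆)·Σ_i Σ_{v⃗} ((i+1)(1 − 1/E) + ((v(i,v⃗)−1) mod E)/E − v(i,v⃗)/E)·log p·Π_b Pr(v_b)` — abc-iut-c312-1's R22
`realPrimePacketWith_negLogThetaPerImageAt_eq_of_tame` BY NAME, its bracket rewritten by `bracket_eq_credit_of_tame_of_const`; label `j = i+1`.
[cite: Mochizuki2012, IUTchIII Cor. 3.12 proof Step (x) p. 181] [cite: DupuyHilado2025, Def. 3.6.3, §4.12] [claim: Mochizuki2012, status: disputed] -/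
theorem realPrimePacketWith_negLogThetaPerImageAt_eq_credit_of_tame (hp2 : 2 < p) {lstar : ℕ}
    (t : Fin lstar → (v : placesOver F p) → (𝔽.k v)ˣ) {E : ℕ}
    (hE : ∀ w : placesOver F p, absRamificationIdx p (𝔽.k w) = E) (hEt : E ≤ p - 2)
    (v : (i : Fin lstar) → (Fin ((i : ℕ) + 1 + 1) → placesOver F p) → ℤ)
    (hv : ∀ (i : Fin lstar) (e : Fin ((i : ℕ) + 1 + 1) → placesOver F p),
      ‖(t i (e (Fin.last _)) : 𝔽.k (e (Fin.last _)))‖ =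
        (p : ℝ) ^ (-(v i e / (absRamificationIdx p (𝔽.k (e (Fin.last _))) : ℝ)))) :
    (realPrimePacketWith p 𝔽 c hc0 hcσ).negLogThetaPerImageAt lstar t =
      (1 / (lstar : ℝ)) * ∑ i : Fin lstar, ∑ e : Fin ((i : ℕ) + 1 + 1) → placesOver F p,
        ((((i : ℕ) + 1 : ℕ) : ℝ) * (1 - 1 / (E : ℝ)) + (((v i e - 1) % (E : ℤ) : ℤ) : ℝ) / E - (v i e : ℝ) / E) *
            Real.log p *
          ∏ b, weight F (e b).1 := by
  rw [realPrimePacketWith_negLogThetaPerImageAt_eq_of_tame p 𝔽 c hc0 hcσ hp2 t (fun w => (hE w).le.trans hEt) v hv]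
  congr 1
  refine Finset.sum_congr rfl fun i _ => Finset.sum_congr rfl fun e _ => ?_
  have hE0 : 0 < E := by rw [← hE (e (Fin.last _))]; exact absRamificationIdx_pos p _
  have key := bracket_eq_credit_of_tame_of_const p (fun b => 𝔽.k (e b)) hp2 (fun b => hE (e b)) hEt hE0 (v i e)
    ((i : ℕ) + 1) (by simp)
  rw [hE (e (Fin.last _))]
  rw [Fintype.card_fin] at key ⊢
  linear_combination (∏ b, weight F (e b).1) * key

end RealPacketWith

/-! ## §4 The KEY's toy: `l = 7` (`ℓ⋆ = 3` labels), `c_p = 15`, `e = 105 ≤ p − 2` (`p ≥ 107`), slots `v_p ∈ {2, 4, 8}` (`s′ = v_p/2`, `v_j = 15·s′·j²`) -/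

/-- **The memo's closed form of `φ_j` at the toy, label by label**: for `s′ ∈ {1,2,4}` and `j ∈ {1,2,3}`,
`(15·s′·j² − 1) mod 105 = 15·(s′j² mod 7) − 1` (values `14, 59, 29` / `29, 14, 59` / `59, 29, 14`).
[cite: DupuyHilado2025, §4.12] -/
theorem toy_emod_eq_memo :
    ∀ s' ∈ ({1, 2, 4} : Finset ℕ), ∀ j ∈ ({1, 2, 3} : Finset ℕ),
      ((15 * s' * j ^ 2 - 1 : ℕ) : ℤ) % 105 = 15 * ((s' * j ^ 2 % 7 : ℕ) : ℤ) - 1 := by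
  decide

/-- **Second reading of the KEY's «l* = l = 7» (labels `j = 1…7`).** On the memo's OWN range (`l ∤ s′j²`, i.e. `j ≠ 7` here) the closed
form persists: for `s′ ∈ {1,2,4}`, `j ∈ {4,5,6}`, `(15·s′·j² − 1) mod 105 = 15·(s′j² mod 7) − 1`. [cite: DupuyHilado2025, §4.12] -/
theorem toy_emod_eq_memo_reading_B :
    ∀ s' ∈ ({1, 2, 4} : Finset ℕ), ∀ j ∈ ({4, 5, 6} : Finset ℕ),
      ((15 * s' * j ^ 2 - 1 : ℕ) : ℤ) % 105 = 15 * ((s' * j ^ 2 % 7 : ℕ) : ℤ) - 1 := by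
  decide

/-- **The label `j = l = 7` of the second reading lies OUTSIDE the memo's hypothesis** (`l ∣ s′j²`): there R22's `φ_7 = ((v_7 − 1) mod 105)/105
= 104/105` while the memo's closed form would read `(15·0 − 1)/105 = −1/105` — a separating instance, recorded so that the closed form is used
only on `j ≤ ℓ⋆ < l` as the memo states (`CondP2`, `l ∤ v_p`); §1–§3 are unaffected (they hold for every `j`). [cite: DupuyHilado2025, §4.12] -/
theorem toy_label_seven_outside_memo_range :
    ∀ s' ∈ ({1, 2, 4} : Finset ℕ),
      ((15 * s' * 7 ^ 2 - 1 : ℕ) : ℤ) % 105 = 104 ∧ 15 * ((s' * 7 ^ 2 % 7 : ℕ) : ℤ) - 1 = -1 := by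
  decide

/-- **Slot `v_p = 2`** (`s′ = 1`, `v_j = 15, 60, 135`): R22's label coefficient `−((v_j−1) div 105 + 1 − (j+1)) − (j+1)/105` EQUALS the memo's
«`j(1 − 1/105) + (15(j² mod 7) − 1)/105 − v_j/105`» for `j = 1, 2, 3` — outcome (α) MATCH. [cite: DupuyHilado2025, §4.12] -/
theorem slot_two :
    ((-(((15 : ℤ) - 1) / 105 + 1 - ((1 + 1 : ℕ) : ℤ)) : ℤ) : ℝ) + -(((1 + 1 : ℕ) : ℝ) * (1 / (105 : ℝ))) =
        (1 : ℝ) * (1 - 1 / 105) + (15 * 1 - 1) / 105 - 15 / 105 ∧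
      ((-(((60 : ℤ) - 1) / 105 + 1 - ((2 + 1 : ℕ) : ℤ)) : ℤ) : ℝ) + -(((2 + 1 : ℕ) : ℝ) * (1 / (105 : ℝ))) =
        (2 : ℝ) * (1 - 1 / 105) + (15 * 4 - 1) / 105 - 60 / 105 ∧
      ((-(((135 : ℤ) - 1) / 105 + 1 - ((3 + 1 : ℕ) : ℤ)) : ℤ) : ℝ) + -(((3 + 1 : ℕ) : ℝ) * (1 / (105 : ℝ))) =
        (3 : ℝ) * (1 - 1 / 105) + (15 * 2 - 1) / 105 - 135 / 105 := by
  norm_num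

/-- **Slot `v_p = 4`** (`s′ = 2`, `v_j = 30, 120, 270`; `2j² mod 7 = 2, 1, 4`): R22's label coefficient EQUALS the memo's form — (α) MATCH.
[cite: DupuyHilado2025, §4.12] -/
theorem slot_four :
    ((-(((30 : ℤ) - 1) / 105 + 1 - ((1 + 1 : ℕ) : ℤ)) : ℤ) : ℝ) + -(((1 + 1 : ℕ) : ℝ) * (1 / (105 : ℝ))) =
        (1 : ℝ) * (1 - 1 / 105) + (15 * 2 - 1) / 105 - 30 / 105 ∧
      ((-(((120 : ℤ) - 1) / 105 + 1 - ((2 + 1 : ℕ) : ℤ)) : ℤ) : ℝ) + -(((2 + 1 : ℕ) : ℝ) * (1 / (105 : ℝ))) =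
        (2 : ℝ) * (1 - 1 / 105) + (15 * 1 - 1) / 105 - 120 / 105 ∧
      ((-(((270 : ℤ) - 1) / 105 + 1 - ((3 + 1 : ℕ) : ℤ)) : ℤ) : ℝ) + -(((3 + 1 : ℕ) : ℝ) * (1 / (105 : ℝ))) =
        (3 : ℝ) * (1 - 1 / 105) + (15 * 4 - 1) / 105 - 270 / 105 := by
  norm_num

/-- **Slot `v_p = 8`** (`s′ = 4`, `v_j = 60, 240, 540`; `4j² mod 7 = 4, 2, 1`): R22's label coefficient EQUALS the memo's form — (α) MATCH.
[cite: DupuyHilado2025, §4.12] -/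
theorem slot_eight :
    ((-(((60 : ℤ) - 1) / 105 + 1 - ((1 + 1 : ℕ) : ℤ)) : ℤ) : ℝ) + -(((1 + 1 : ℕ) : ℝ) * (1 / (105 : ℝ))) =
        (1 : ℝ) * (1 - 1 / 105) + (15 * 4 - 1) / 105 - 60 / 105 ∧
      ((-(((240 : ℤ) - 1) / 105 + 1 - ((2 + 1 : ℕ) : ℤ)) : ℤ) : ℝ) + -(((2 + 1 : ℕ) : ℝ) * (1 / (105 : ℝ))) =
        (2 : ℝ) * (1 - 1 / 105) + (15 * 2 - 1) / 105 - 240 / 105 ∧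
      ((-(((540 : ℤ) - 1) / 105 + 1 - ((3 + 1 : ℕ) : ℤ)) : ℤ) : ℝ) + -(((3 + 1 : ℕ) : ℝ) * (1 / (105 : ℝ))) =
        (3 : ℝ) * (1 - 1 / 105) + (15 * 1 - 1) / 105 - 540 / 105 := by
  norm_num

/-- **Slot sums at the toy.** In every slot the debit is `Σ_{j≤3} v_j/105 = v_p` (`(15 + 60 + 135)/105 = 2`, `(30 + 120 + 270)/105 = 4`,
`(60 + 240 + 540)/105 = 8`) and the credit is `Σ_{j≤3} (j(1 − 1/105) + φ_j) = 6·(104/105) + (14 + 59 + 29)/105 = 242/35` (the three `φ_j` are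
the same set in every slot — `s′ = 1, 2, 4` are squares mod 7). [cite: DupuyHilado2025, §4.12] -/
theorem slot_sums :
    ((15 : ℚ) + 60 + 135) / 105 = 2 ∧ ((30 : ℚ) + 120 + 270) / 105 = 4 ∧ ((60 : ℚ) + 240 + 540) / 105 = 8 ∧
      ((1 : ℚ) + 2 + 3) * (1 - 1 / 105) + (14 + 59 + 29) / 105 = 242 / 35 := by
  norm_num

/-- **The memo's threshold at the toy, both closed forms** (`l = 7`, `ℓ⋆ = 3`, `c_p = 15`, `e = 105`, `Φ = 102/105`, class number `h(−7) = 1`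
entered as the numeral `1`, quadratic-residue sign `−`): `v*_p = 6(1 − 1/e) + 48Φ/(l² − 1) = 6 + 12/(l+1) − 6(l+5)/(c_p·l·(l+1)) − 24·h(−7)/(l² − 1)
= 242/35` — and it equals credit-sum-per-debit-unit `Σ_{j≤3}(j(1 − 1/e) + φ_j)` of `slot_sums` (debit `= v_p·log p`). [cite: DupuyHilado2025, §4.12] -/
theorem toy_threshold :
    (6 : ℚ) * (1 - 1 / 105) + 48 * (102 / 105) / (7 ^ 2 - 1) = 242 / 35 ∧
      (6 : ℚ) + 12 / (7 + 1) - 6 * (7 + 5) / (15 * 7 * (7 + 1)) - 24 * 1 / (7 ^ 2 - 1) = 242 / 35 := by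
  norm_num

end TameCreditCheck

end Literature.IUT.LogVolume

end
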